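import Summits.QuantumFields.YangMills.Theorems.UnitScaleTiltProp7CoarseFineKernelRows
import HarnessLib

/-!
# Route `UnitScaleTilt`, crux K1 «MinimiserStabilityRegPr» (stmt-QuantumFields-19200), EX face — K137 STOREY, road (K4) of LOCATE-K137, FILE (K4-door):
# **THE TUBE-TERM DOOR FOR THE EX ROW `hCk`** — the fine→fine pointwise kernel row of `Q_k†(Q_kGQ_k†)⁻¹Q_kG` (entries `O(ℓ⁻³)e^{−δ·dc}`) from TWO displayed letters — the coarse entry row of
# `(Q_kGQ_k†)⁻¹` and the BLOCK-`ℓ¹` COLUMN of `G = G_T` at the same slot — by the two tube rows of the averaging operator of record and two Schur compositions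

Cell `ym3-torus` (HUMAN RULING D-0037; rung R3 = SU(2) YM₃ on T³ — NOT d = 4, NOT infinite volume, NOT a mass gap, NOT Clay).  Width seat `ym3-torus-px10` (gen 13; FREE px);
★`ym-ust-19200-p1` g27 CHAIR WORD №25 (3) «(K3): GO»; LOCATE `HOME/ym3-torus-px10/g13/LOCATE-K3-QKDAGGER-DOOR-px10g13.md` (19200 evidence #48) §3 (C).  THEOREMS ONLY (0 `def`, 0 `sorry`,
default heartbeats); `--supports stmt-QuantumFields-19200 --as helper`; count-neutral.  Parts 1–2 = ✓`…Prop7CoarseFineKernelRows` (Schur compositions + tube rows), `…Prop7Kernel137DoorOfKinvEntry`.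

THE ROW (EX display S47 ✓`Prop7StubEXOfChartPiecesTwS47` ll.244–254; consumer ✓`Prop7Op137OfKernelRows.hOpC_of_kernelC_family`).  `hCk` :=
`‖toL2⁻¹(Q_k†((Q_kGQ_k†)⁻¹(Q_k(G(toL2(δ_b ⊗ Z))))))(bd)‖ ≤ CC·ℓ⁻³·e^{−δC·tdist(B b, B bd)}·‖Z‖` at the slot `Δ^η + T_Jᴾ` — the kernel of the tube term of print's `𝔓` ((3.147), bounded on
p.426 «through Thm 3.3 and the Gram-inverse kernels»); the `ℓ⁻³` is (3.11)'s `η^d`, in the display's weights carried by `G`'s fine row (`CG·ℓ⁻³`, the `h349` currency) — `Q_k`'s own `ℓ⁻³`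
is where the row's `ℓ⁻³` comes from PROVIDED the `G`-factor is read through its BLOCK-`ℓ¹` COLUMN (`Σ_{bd ∈ block} |G(bd,b)| = O(1)`, print's (3.46)) and NOT through a pointwise row times the
fine volume `3ℓ³` (px16 g13's scaling flag 2026-08-30 09:49:55Z: a K-free POINTWISE `ℓ⁻³`-row of `G` is not inhabitable — true entries are `∼ ℓ⁻²∕(1+|x|)`); `Q_k†`'s `(cB∕c₀)ℓ⁻³` is eaten by
`K⁻¹`'s `(c₀∕cB)ℓ³`.
THE DISPLAYED LETTERS (same rate `δ`; callers weaken to the smaller of two rates first):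
  `hKinv : ∀ y Z y′, ‖toL2B⁻¹((Q_kGQ_k†)⁻¹_{Δx}(toL2B(δ_y ⊗ Z)))(y′)‖ ≤ C_K·e^{−δ·tdist(ŷ′, ŷ)}·‖Z‖` (px12 ✓p767718's currency; family scaling `C_K = CK L·(c₀∕cB)ℓ³`),
  `hGcol : ∀ b Z y, Σ_{bd : B bd = y} ‖toL2⁻¹(G_{Δx}(toL2(δ_b ⊗ Z)))(bd)‖ ≤ C_G·e^{−δ·tdist(y, B b)}·‖Z‖` (the block-`ℓ¹` column of `G`'s fine kernel, `C_G = O(1)` K-free — px16 g13's (K2-L1)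
  offer `…OneFormGreenBlockColumn` at `Δx := DeltaEtaSlot` under Lift; at the row's slot `Δ^η + T_Jᴾ` the (K1-alg)∕N6 road's output).
THE ARGUMENT.  §0 ★★`kernelRow_Qk_comp_of_blockColumn_of_regPr` — the SIBLING of part 1's `kernelRow_FC_comp_FF` that consumes a block-`ℓ¹` column: `toL2B⁻¹(Q_k(BX))(y′) = η·Σ_{b′}QTwS(δ_{b′}W(b′))(y′)`,
only the `b′` in the two blocks read by `y′` survive (px21 ✓`QTwS_single_eq_zero_of_not_read`), each `≤ C_Qℓ⁻²‖W b′‖` (one term of px13 ✓`col_of_regPr`, `C_Q ≤ 5`), and the two block sums are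
the letter at `ŷ′` and `ŷ′⁺` (`tdist(ŷ′⁺, B b) ≥ tdist(ŷ′, B b) − 1`): FC(Q_k∘B; 5ℓ⁻³(1+e^{δ})C_B, δ).  Then `K⁻¹ ∘ (Q_kG)` (part 1 ★`kernelRow_CC_comp_FC`, `r = ν = δ∕2`: `× C_K·3(2(1+2∕δ))³`), then
`Q_k† ∘ (…)` (★`kernelRow_CF_comp_FC`, `Q_k†` at the free rate `δ∕2+1`: `× 10(cB∕c₀)ℓ⁻³e^{δ∕2+1}·192`, rate `δ∕2` KEPT).
WHAT IS PROVED (ns `Summit.QuantumFields.YangMills.Theorems.Prop7KernelCDoorOfKinvEntry`).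
* §0 ★★ `kernelRow_Qk_comp_of_blockColumn_of_regPr` (`RegPr` + the two windows; any fine→fine `B`, any rate `μ ≥ 0`).
* §1 ★★★ `kernelC_of_kinvRow_of_greenColumn` — MEMBER, GENERIC SLOT `Δx`, coupling `a : ℝ`: `RegPr F n K ε₀ U₀` + the two windows + `hKinv` + `hGcol` ⟹ the `hCk` member text (product constant
  displayed as the compositions leave it) at rate `δ∕2`.
* §2 ★★★ `kernelC_family_of_kinvRow_of_greenColumn` — Idx EDITION, GENERIC SLOT AND THREAD `Λ`, windowed cap `α`, `hKinv` in the family scaling and `hGcol` with an L-ONLY `CG L` ⟹ the S47 ROW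
  TEXT of `hCk` (at `Δx L i`) with `CC L := 28800·e^{δ L∕2+1}·(1+e^{δ L})·CK L·CG L·(2(1+2∕δ L))³` (L-ONLY) times `((L:ℝ)^(K−n))⁻¹^3`, rate `δC L := δ L∕2`.
HYP-SAT (★★OWNER №42).  RegPr + windows inhabited on the literal families; `hKinv`, `hGcol` displayed letters in currencies of record (px12 ✓p767718 ∕ px16's N4–(K2-L1) lineage), class (1)
sockets, not restatements of the conclusion (a fine→fine row of a FOUR-factor composite).  HONEST SCOPE.  Schur bookkeeping over part 1; no estimate of print is proved; nothing of (3.132),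
the `K⁻¹` entry rows, `G`'s block column, the other EX rows, EX or the crux is proved here; the Yang–Mills mass gap is NOT proved.

References: T. Bałaban, CMP **99** (1985) 389–434 [Balaban1985BackgroundPropagators] ((3.11) p.392, (3.13)–(3.16) p.393, (3.46) p.398, (3.132)–(3.133) p.422, (3.147)–(3.153) pp.425–426);
CMP **102** (1985) 277–309 [Balaban1985Variational] ((133), (137) p.298); CMP **96** (1984) 223–250 [Balaban1984PropagatorsII] (§2, (2.61) p.234).
-/

set_option autoImplicit false

noncomputable section

open scoped BigOperators Matrix.Norms.L2Operator InnerProductSpace ComplexConjugate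

namespace Summit.QuantumFields.YangMills.Theorems.Prop7KernelCDoorOfKinvEntry

open Literature.MathematicalPhysics.QuantumFieldTheory.Balaban1983to89
open Literature.MathematicalPhysics.QuantumFieldTheory.Balaban1983to89.T3ContinuumYM3Torus
open Literature.MathematicalPhysics.QuantumFieldTheory.Balaban1983to89.T3Thm1Carrier
open T3PrintedRegularMinimiser (RegPr)
open T3PrintedMinimiserExistence (regPr_mono)
open T3PrintedRegularOrbits (sites_eq)
open T3LevelShift (siteShift)
open B9Eq311L2Pairing (WL2)
open B11Eq103H1Complex (BondL2K)
open B5Eq118OneStroke (iterBlockOf)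
open Summit.QuantumFields.YangMills.Theorems.Prop7SectET3Transport (periodsT3)
open Summit.QuantumFields.YangMills.Theorems.Prop7SectET3HilbertLetters (W₂ toL2 toL2B)
open Summit.QuantumFields.YangMills.Theorems.Prop7SectET3CurvedPropagators (Qk GT KinvT)
open T3SectALandauChart (eta eta_pos)
open T3LevelShift (bondShift bondShift_src)
open Summit.QuantumFields.YangMills.Theorems.Prop7SymAvgTwSym (QTwS)
open Summit.QuantumFields.YangMills.Theorems.Prop7QkPenaltyKernelRow (QTwS_single_eq_zero_of_not_read)
open Summit.QuantumFields.YangMills.Theorems.Prop7QTwSColumnBound (col_of_regPr col_const_le_five)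
open Summit.QuantumFields.YangMills.Theorems.Prop7BlockDistanceWeights (tdist_src_tgt_le_one tdist_coarse_comm tdist_coarse_triangle)
open Summit.QuantumFields.YangMills.Theorems.Prop7CoarseFineKernelRows (kernelRow_CC_comp_FC kernelRow_CF_comp_FC kernelRow_adjoint_Qk_of_regPr toL2B_symm_Qk_toL2_apply)

/-! ## §0 ★★ The sibling composition: `Q_k ∘ B` from the block-`ℓ¹` column of `B` -/

section BlockColumn

variable (F : T3Family) {n K : ℕ} (h : n ≤ K) (c₀ cB : ℝ)

/-- ★★ **FC(Q_k ∘ B) FROM THE BLOCK-`ℓ¹` COLUMN OF `B`, UNCONDITIONAL AT `RegPr`** (the sibling of part 1's `kernelRow_FC_comp_FF` that does NOT multiply a pointwise row by the fine volume):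
`RegPr F n K ε₀ U₀`, `10¹⁰L⁶ε₀ ≤ 1`, `10¹²L³ε₀ ≤ 1`, `0 ≤ μ`, and for a fine→fine `B` the displayed block column `Σ_{bd : B bd = y}‖toL2⁻¹(B(toL2 δ_bZ))(bd)‖ ≤ C_B·e^{−μ·tdist(y, B b)}·‖Z‖` ⟹
`‖toL2B⁻¹(Q_k(B(toL2 δ_bZ)))(y′)‖ ≤ (5ℓ⁻³(1+e^{μ})C_B)·e^{−μ·tdist(ŷ′, B b)}·‖Z‖` — only the two blocks `ŷ′`, `ŷ′⁺` read by `y′` contribute (px21 ✓`QTwS_single_eq_zero_of_not_read`), each bond by one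
term of (COL) (px13 ✓`col_of_regPr`, `C_Q ≤ 5`), `η·ℓ⁻² = ℓ⁻³`, `tdist(ŷ′⁺, B b) ≥ tdist(ŷ′, B b) − 1`. [cite: Balaban1985BackgroundPropagators, (3.13)–(3.16) p.393, (3.46) p.398, (3.147) p.425; Balaban1984PropagatorsI, (1.18) p.20] -/
theorem kernelRow_Qk_comp_of_blockColumn_of_regPr {ε₀ : ℝ} (hε₀ : 0 < ε₀) (hε : 10 ^ 10 * (F.L : ℝ) ^ 6 * ε₀ ≤ 1) (hε12 : 10 ^ 12 * (F.L : ℝ) ^ 3 * ε₀ ≤ 1)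
    (U₀ : GaugeField (F.P K) 0 (Matrix.specialUnitaryGroup (Fin 2) ℂ)) (hreg : RegPr F n K ε₀ U₀)
    (B : BondL2K ℂ 3 (periodsT3 F K) c₀ W₂ →ₗ[ℂ] BondL2K ℂ 3 (periodsT3 F K) c₀ W₂) {CB μ : ℝ} (hCB : 0 ≤ CB) (hμ : 0 ≤ μ)
    (hBcol : ∀ (b : PBond (F.P K) 0) (Z : Matrix (Fin 2) (Fin 2) ℂ) (y : Site (F.P K) (K - n)),
      ∑ bd ∈ Finset.univ.filter (fun bd : PBond (F.P K) 0 => iterBlockOf (K - n) bd.src = y), ‖(toL2 F K c₀).symm (B (toL2 F K c₀ (Pi.single b Z))) bd‖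
        ≤ CB * Real.exp (-(μ * (Site.tdist (P := F.P K) y (iterBlockOf (K - n) b.src) : ℝ))) * ‖Z‖)
    (b : PBond (F.P K) 0) (Z : Matrix (Fin 2) (Fin 2) ℂ) (y' : PBond (F.P n) 0) :
    ‖(toL2B F n cB).symm ((Qk F n K h c₀ cB U₀ ∘ₗ B) (toL2 F K c₀ (Pi.single b Z))) y'‖
      ≤ (5 * ((F.L : ℝ) ^ (K - n))⁻¹ ^ 3 * (1 + Real.exp μ) * CB)
          * Real.exp (-(μ * (Site.tdist (P := F.P K) (siteShift (sites_eq F n K h) y'.src) (iterBlockOf (K - n) b.src) : ℝ))) * ‖Z‖ := by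
  classical
  have hL0 : (0 : ℝ) < F.L := by exact_mod_cast lt_trans zero_lt_one F.hL.2
  have hℓ : (0 : ℝ) < (F.L : ℝ) ^ (K - n) := pow_pos hL0 _
  have hη : 0 < eta F n K := eta_pos F n K
  have hηℓ : eta F n K = ((F.L : ℝ) ^ (K - n))⁻¹ := by
    show ((F.L : ℝ)⁻¹) ^ (K - n) = ((F.L : ℝ) ^ (K - n))⁻¹; rw [inv_pow]
  -- the middle vector `W` and its bond-spike expansion under `QTwS`
  set W : PBond (F.P K) 0 → Matrix (Fin 2) (Fin 2) ℂ := (toL2 F K c₀).symm (B (toL2 F K c₀ (Pi.single b Z))) with hW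
  have hBW : B (toL2 F K c₀ (Pi.single b Z)) = toL2 F K c₀ W := by rw [hW, LinearEquiv.apply_symm_apply]
  rw [LinearMap.comp_apply, hBW, toL2B_symm_Qk_toL2_apply, norm_smul, Complex.norm_real, Real.norm_of_nonneg hη.le]
  have hsum : QTwS F n K h U₀ W y' = ∑ b' : PBond (F.P K) 0, QTwS F n K h U₀ (Pi.single b' (W b')) y' := by
    conv_lhs => rw [← Finset.univ_sum_single W]
    rw [map_sum, Finset.sum_apply]
  -- the two blocks read by `y′`
  set s : Site (F.P K) (K - n) := (bondShift (sites_eq F n K h) y').src with hs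
  set t : Site (F.P K) (K - n) := (bondShift (sites_eq F n K h) y').tgt with ht
  have hs' : s = siteShift (sites_eq F n K h) y'.src := by rw [hs, bondShift_src]
  have hCQ5 := col_const_le_five F (K := K) hε₀ hε
  have hterm : ∀ b' : PBond (F.P K) 0, ‖QTwS F n K h U₀ (Pi.single b' (W b')) y'‖
      ≤ 5 * ((F.L : ℝ) ^ (K - n))⁻¹ ^ 2 * ((if iterBlockOf (K - n) b'.src = s then ‖W b'‖ else 0) + (if iterBlockOf (K - n) b'.src = t then ‖W b'‖ else 0)) := by
    intro b'
    by_cases hb' : (iterBlockOf (K - n) b'.src = s ∨ iterBlockOf (K - n) b'.src = t)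
    · have hone : ‖QTwS F n K h U₀ (Pi.single b' (W b')) y'‖ ≤ 5 * ((F.L : ℝ) ^ (K - n))⁻¹ ^ 2 * ‖W b'‖ := by
        refine ((Finset.single_le_sum (f := fun c => ‖QTwS F n K h U₀ (Pi.single b' (W b')) c‖) (fun _ _ => norm_nonneg _) (Finset.mem_univ y')).trans
          (col_of_regPr F h hε₀ hε hε12 U₀ hreg b' (W b'))).trans ?_
        have hK0 : 0 ≤ ((F.L : ℝ) ^ (K - n))⁻¹ ^ 2 * ‖W b'‖ := by positivity
        nlinarith [mul_le_mul_of_nonneg_right hCQ5 hK0]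
      refine hone.trans (mul_le_mul_of_nonneg_left ?_ (by positivity))
      rcases hb' with hb' | hb'
      · rw [if_pos hb']; have : 0 ≤ (if iterBlockOf (K - n) b'.src = t then ‖W b'‖ else 0) := by positivity
        linarith
      · rw [if_pos hb']; have : 0 ≤ (if iterBlockOf (K - n) b'.src = s then ‖W b'‖ else 0) := by positivity
        linarith
    · rw [QTwS_single_eq_zero_of_not_read F h hε₀ hε12 U₀ hreg b' (W b') y' (by rwa [hs, ht] at hb'), norm_zero]
      positivity
  -- the two block sums are the displayed column letter at `s = ŷ′` and at `t = ŷ′⁺`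
  have hblk : ∀ y : Site (F.P K) (K - n), ∑ b' : PBond (F.P K) 0, (if iterBlockOf (K - n) b'.src = y then ‖W b'‖ else 0)
      ≤ CB * Real.exp (-(μ * (Site.tdist (P := F.P K) y (iterBlockOf (K - n) b.src) : ℝ))) * ‖Z‖ := by
    intro y
    rw [← Finset.sum_filter]
    exact hBcol b Z y
  have hts : (Site.tdist (P := F.P K) s (iterBlockOf (K - n) b.src) : ℝ) ≤ 1 + (Site.tdist (P := F.P K) t (iterBlockOf (K - n) b.src) : ℝ) := by
    have h1 : (Site.tdist (P := F.P K) s t : ℝ) ≤ 1 := by rw [hs, ht]; exact_mod_cast tdist_src_tgt_le_one _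
    linarith [tdist_coarse_triangle F s t (iterBlockOf (K - n) b.src)]
  have hexp_t : Real.exp (-(μ * (Site.tdist (P := F.P K) t (iterBlockOf (K - n) b.src) : ℝ)))
      ≤ Real.exp μ * Real.exp (-(μ * (Site.tdist (P := F.P K) s (iterBlockOf (K - n) b.src) : ℝ))) := by
    rw [← Real.exp_add, Real.exp_le_exp]; nlinarith
  have hQ : ‖QTwS F n K h U₀ W y'‖ ≤ 5 * ((F.L : ℝ) ^ (K - n))⁻¹ ^ 2 * ((1 + Real.exp μ) * CB
      * Real.exp (-(μ * (Site.tdist (P := F.P K) s (iterBlockOf (K - n) b.src) : ℝ))) * ‖Z‖) := by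
    rw [hsum]
    refine (norm_sum_le _ _).trans ((Finset.sum_le_sum fun b' _ => hterm b').trans ?_)
    rw [← Finset.mul_sum, Finset.sum_add_distrib]
    refine mul_le_mul_of_nonneg_left ?_ (by positivity)
    have h1 := hblk s
    have h2 := (hblk t).trans (mul_le_mul_of_nonneg_right (mul_le_mul_of_nonneg_left hexp_t hCB) (norm_nonneg _))
    have hZ0 : 0 ≤ CB * Real.exp (-(μ * (Site.tdist (P := F.P K) s (iterBlockOf (K - n) b.src) : ℝ))) * ‖Z‖ := by positivity
    nlinarith [h1, h2, hZ0]
  rw [← hs']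
  calc eta F n K * ‖QTwS F n K h U₀ W y'‖
      ≤ eta F n K * (5 * ((F.L : ℝ) ^ (K - n))⁻¹ ^ 2 * ((1 + Real.exp μ) * CB
          * Real.exp (-(μ * (Site.tdist (P := F.P K) s (iterBlockOf (K - n) b.src) : ℝ))) * ‖Z‖)) := mul_le_mul_of_nonneg_left hQ hη.le
    _ = _ := by rw [hηℓ]; ring

end BlockColumn

/-! ## §1 ★★★ The member door at a generic slot -/

section Member

variable (F : T3Family) {n K : ℕ} (h : n ≤ K) (c₀ cB : ℝ) [Fact (0 < c₀)] [Fact (0 < cB)]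

/-- ★★★ **DOOR «KERNEL-C», MEMBER, GENERIC SLOT**: at a printed-regular background (`RegPr F n K ε₀ U₀`, windows `10¹⁰L⁶ε₀ ≤ 1`, `10¹²L³ε₀ ≤ 1`), any coupling `a` and slot `Δx`, the displayed
coarse entry row `hKinv` of `K⁻¹ = KinvT … a Δx U₀` and the displayed block-`ℓ¹` column `hGcol` of `G_T … a Δx U₀`, both at rate `δ > 0`, give the `hCk` MEMBER TEXT — the fine→fine pointwise
kernel row of the tube composite `Q_k†K⁻¹Q_kG_T` — at rate `δ∕2`, with the product constant of §0 and the two compositions (`K⁻¹∘(Q_kG_T)`, `Q_k†∘(…)`).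
[cite: Balaban1985BackgroundPropagators, (3.147)–(3.153) pp.425–426, (3.132)–(3.133) p.422, (3.46) p.398; Balaban1985Variational, (133) p.298; Balaban1984PropagatorsII, (2.61) p.234] -/
theorem kernelC_of_kinvRow_of_greenColumn {ε₀ : ℝ} (hε₀ : 0 < ε₀) (hε : 10 ^ 10 * (F.L : ℝ) ^ 6 * ε₀ ≤ 1) (hε12 : 10 ^ 12 * (F.L : ℝ) ^ 3 * ε₀ ≤ 1)
    (U₀ : GaugeField (F.P K) 0 (Matrix.specialUnitaryGroup (Fin 2) ℂ)) (hreg : RegPr F n K ε₀ U₀) (a : ℝ)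
    (Δx : GaugeField (F.P K) 0 (Matrix.specialUnitaryGroup (Fin 2) ℂ) → (BondL2K ℂ 3 (periodsT3 F K) c₀ W₂ →ₗ[ℂ] BondL2K ℂ 3 (periodsT3 F K) c₀ W₂))
    {CK CG δ : ℝ} (hCK : 0 ≤ CK) (hCG : 0 ≤ CG) (hδ : 0 < δ)
    (hKinv : ∀ (y : PBond (F.P n) 0) (Z : Matrix (Fin 2) (Fin 2) ℂ) (y' : PBond (F.P n) 0),
      ‖(toL2B F n cB).symm (KinvT F n K h c₀ cB a Δx U₀ (toL2B F n cB (Pi.single y Z))) y'‖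
        ≤ CK * Real.exp (-(δ * (Site.tdist (P := F.P K) (siteShift (sites_eq F n K h) y'.src) (siteShift (sites_eq F n K h) y.src) : ℝ))) * ‖Z‖)
    (hGcol : ∀ (b : PBond (F.P K) 0) (Z : Matrix (Fin 2) (Fin 2) ℂ) (y : Site (F.P K) (K - n)),
      ∑ bd ∈ Finset.univ.filter (fun bd : PBond (F.P K) 0 => iterBlockOf (K - n) bd.src = y),
          ‖(toL2 F K c₀).symm (GT F n K h c₀ cB a Δx U₀ (toL2 F K c₀ (Pi.single b Z))) bd‖
        ≤ CG * Real.exp (-(δ * (Site.tdist (P := F.P K) y (iterBlockOf (K - n) b.src) : ℝ))) * ‖Z‖)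
    (b : PBond (F.P K) 0) (Z : Matrix (Fin 2) (Fin 2) ℂ) (bd : PBond (F.P K) 0) :
    ‖(toL2 F K c₀).symm (LinearMap.adjoint (Qk F n K h c₀ cB U₀) (KinvT F n K h c₀ cB a Δx U₀
        (Qk F n K h c₀ cB U₀ (GT F n K h c₀ cB a Δx U₀ (toL2 F K c₀ (Pi.single b Z)))))) bd‖
      ≤ ((2 * 5 * (cB / c₀) * ((F.L : ℝ) ^ (K - n))⁻¹ ^ 3 * Real.exp (δ / 2 + 1))
            * (CK * (5 * ((F.L : ℝ) ^ (K - n))⁻¹ ^ 3 * (1 + Real.exp δ) * CG) * (3 * (2 * (1 + 1 / (δ / 2))) ^ 3))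
            * (3 * (2 * (1 + 1 / 1)) ^ 3))
          * Real.exp (-(δ / 2 * (Site.tdist (P := F.P K) (iterBlockOf (K - n) b.src) (iterBlockOf (K - n) bd.src) : ℝ))) * ‖Z‖ := by
  have hc₀ : 0 < c₀ := Fact.out
  have hcB : 0 < cB := Fact.out
  have hL0 : (0 : ℝ) < F.L := by exact_mod_cast lt_trans zero_lt_one F.hL.2
  have hδ2 : 0 ≤ δ / 2 + 1 := by linarith
  have hδh : 0 < δ / 2 := by linarith
  -- (1) `Q_k ∘ G_T` : fine → coarse, rate `δ`, through the block column (§0)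
  have hS := kernelRow_Qk_comp_of_blockColumn_of_regPr F h c₀ cB hε₀ hε hε12 U₀ hreg (GT F n K h c₀ cB a Δx U₀) hCG hδ.le hGcol
  -- (2) `K⁻¹ ∘ (Q_kG_T)` : fine → coarse, rate `δ∕2` (`ν = δ∕2` through `K⁻¹`'s rate)
  have hMS := kernelRow_CC_comp_FC F h c₀ cB (KinvT F n K h c₀ cB a Δx U₀) (Qk F n K h c₀ cB U₀ ∘ₗ GT F n K h c₀ cB a Δx U₀) (r := δ / 2) (ν := δ / 2)
    hCK (by positivity) hδh.le (by linarith) hδh (by linarith) hKinv hS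
  -- (3) `Q_k† ∘ (K⁻¹Q_kG_T)` : fine → fine, rate `δ∕2` KEPT (outer absorption through `Q_k†`'s free rate `δ∕2 + 1`)
  have hTMS := kernelRow_CF_comp_FC F h c₀ cB (LinearMap.adjoint (Qk F n K h c₀ cB U₀))
    (KinvT F n K h c₀ cB a Δx U₀ ∘ₗ (Qk F n K h c₀ cB U₀ ∘ₗ GT F n K h c₀ cB a Δx U₀)) (r := δ / 2) (ν := 1)
    (by positivity) (by positivity) hδh.le le_rfl one_pos (by linarith) (kernelRow_adjoint_Qk_of_regPr F h c₀ cB hε₀ hε hε12 U₀ hreg hδ2) hMS b Z bd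
  simpa only [LinearMap.comp_apply] using hTMS

end Member

/-! ## §2 ★★★ The Idx edition: generic slot, generic thread, windowed cap, family scalings -/

section Family

/-- ★★★ **DOOR «KERNEL-C», Idx EDITION, GENERIC SLOT AND THREAD**: for a cap `α` with the windows of record, L-only weights `c₀ cB`, a member coupling `a L i`, slots `Δx L i`, ANY thread
`Λ L i U₀` (S47: the `Lift` antecedent of record), and the two displayed family letters at a common rate `δ L > 0` — `hKinv` (coarse entry row of `K⁻¹`, constant `CK L·((c₀ L∕cB L)·ℓ³)`) and
`hGcol` (block-`ℓ¹` column of `G_T`'s fine kernel at the slot, L-ONLY constant `CG L` — print's (3.46) `O(1)`) — the S47 ROW TEXT of `hCk` (at the slot `Δx L i`) holds under the same thread with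
the L-ONLY constant `CC L := 28800·e^{δ L∕2+1}·(1+e^{δ L})·CK L·CG L·(2(1+2∕δ L))³` times `((L:ℝ)^(K−n))⁻¹^3`, at rate `δ L∕2`.
[cite: Balaban1985BackgroundPropagators, (3.11) p.392, (3.46) p.398, (3.147)–(3.153) pp.425–426, (3.132)–(3.133) p.422; Balaban1985Variational, (133) p.298; Balaban1984PropagatorsII, (2.61) p.234] -/
theorem kernelC_family_of_kinvRow_of_greenColumn
    (α : ℕ → ℝ) (hα : ∀ L : ℕ, 1 < L → 0 < α L) (hW : ∀ L : ℕ, 1 < L → 10 ^ 10 * (L : ℝ) ^ 6 * α L ≤ 1) (hW' : ∀ L : ℕ, 1 < L → 10 ^ 12 * (L : ℝ) ^ 3 * α L ≤ 1)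
    (c₀ cB : ℕ → ℝ) [hc₀ : ∀ L : ℕ, Fact (0 < c₀ L)] [hcB : ∀ L : ℕ, Fact (0 < cB L)] (a : ∀ L : ℕ, Idx L → ℝ)
    (Δx : ∀ (L : ℕ) (i : Idx L), GaugeField (i.1.1.P i.1.2.2) 0 (Matrix.specialUnitaryGroup (Fin 2) ℂ) →
      (BondL2K ℂ 3 (periodsT3 i.1.1 i.1.2.2) (c₀ L) W₂ →ₗ[ℂ] BondL2K ℂ 3 (periodsT3 i.1.1 i.1.2.2) (c₀ L) W₂))
    (Λ : ∀ (L : ℕ) (i : Idx L), GaugeField (i.1.1.P i.1.2.2) 0 (Matrix.specialUnitaryGroup (Fin 2) ℂ) → Prop)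
    (CK CG δ : ℕ → ℝ) (hCK : ∀ L, 1 < L → 0 ≤ CK L) (hCG : ∀ L, 1 < L → 0 ≤ CG L) (hδ : ∀ L, 1 < L → 0 < δ L)
    (hKinv : ∀ (L : ℕ), 1 < L → ∀ (i : Idx L) (U₀ : GaugeField (i.1.1.P i.1.2.2) 0 (Matrix.specialUnitaryGroup (Fin 2) ℂ)), ∀ ρ : ℝ, RegPr i.1.1 i.1.2.1 i.1.2.2 ρ U₀ → ρ ≤ α L →
      Λ L i U₀ → ∀ (y : PBond (i.1.1.P i.1.2.1) 0) (Z : Matrix (Fin 2) (Fin 2) ℂ) (y' : PBond (i.1.1.P i.1.2.1) 0),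
        ‖(toL2B i.1.1 i.1.2.1 (cB L)).symm (KinvT i.1.1 i.1.2.1 i.1.2.2 i.2.2.le (c₀ L) (cB L) (a L i) (Δx L i) U₀ (toL2B i.1.1 i.1.2.1 (cB L) (Pi.single y Z))) y'‖
          ≤ CK L * ((c₀ L / cB L) * ((L : ℝ) ^ (i.1.2.2 - i.1.2.1)) ^ 3)
              * Real.exp (-(δ L * (Site.tdist (siteShift (sites_eq i.1.1 i.1.2.1 i.1.2.2 i.2.2.le) y'.src) (siteShift (sites_eq i.1.1 i.1.2.1 i.1.2.2 i.2.2.le) y.src) : ℝ))) * ‖Z‖)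
    (hGcol : ∀ (L : ℕ), 1 < L → ∀ (i : Idx L) (U₀ : GaugeField (i.1.1.P i.1.2.2) 0 (Matrix.specialUnitaryGroup (Fin 2) ℂ)), ∀ ρ : ℝ, RegPr i.1.1 i.1.2.1 i.1.2.2 ρ U₀ → ρ ≤ α L →
      Λ L i U₀ → ∀ (b : PBond (i.1.1.P i.1.2.2) 0) (Z : Matrix (Fin 2) (Fin 2) ℂ) (y : Site (i.1.1.P i.1.2.2) (i.1.2.2 - i.1.2.1)),
        ∑ bd ∈ Finset.univ.filter (fun bd : PBond (i.1.1.P i.1.2.2) 0 => iterBlockOf (i.1.2.2 - i.1.2.1) bd.src = y),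
            ‖(toL2 i.1.1 i.1.2.2 (c₀ L)).symm (GT i.1.1 i.1.2.1 i.1.2.2 i.2.2.le (c₀ L) (cB L) (a L i) (Δx L i) U₀ (toL2 i.1.1 i.1.2.2 (c₀ L) (Pi.single b Z))) bd‖
          ≤ CG L * Real.exp (-(δ L * (Site.tdist y (iterBlockOf (i.1.2.2 - i.1.2.1) b.src) : ℝ))) * ‖Z‖) :
    ∀ (L : ℕ), 1 < L → ∀ (i : Idx L) (U₀ : GaugeField (i.1.1.P i.1.2.2) 0 (Matrix.specialUnitaryGroup (Fin 2) ℂ)), ∀ ρ : ℝ, RegPr i.1.1 i.1.2.1 i.1.2.2 ρ U₀ → ρ ≤ α L →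
      Λ L i U₀ → ∀ (b : PBond (i.1.1.P i.1.2.2) 0) (Z : Matrix (Fin 2) (Fin 2) ℂ) (bd : PBond (i.1.1.P i.1.2.2) 0),
        ‖(toL2 i.1.1 i.1.2.2 (c₀ L)).symm (LinearMap.adjoint (Qk i.1.1 i.1.2.1 i.1.2.2 i.2.2.le (c₀ L) (cB L) U₀) (KinvT i.1.1 i.1.2.1 i.1.2.2 i.2.2.le (c₀ L) (cB L) (a L i) (Δx L i) U₀
            (Qk i.1.1 i.1.2.1 i.1.2.2 i.2.2.le (c₀ L) (cB L) U₀ (GT i.1.1 i.1.2.1 i.1.2.2 i.2.2.le (c₀ L) (cB L) (a L i) (Δx L i) U₀ (toL2 i.1.1 i.1.2.2 (c₀ L) (Pi.single b Z)))))) bd‖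
          ≤ (28800 * Real.exp (δ L / 2 + 1) * (1 + Real.exp (δ L)) * CK L * CG L * (2 * (1 + 2 / δ L)) ^ 3) * ((L : ℝ) ^ (i.1.2.2 - i.1.2.1))⁻¹ ^ 3
              * Real.exp (-(δ L / 2 * (Site.tdist (iterBlockOf (i.1.2.2 - i.1.2.1) b.src) (iterBlockOf (i.1.2.2 - i.1.2.1) bd.src) : ℝ))) * ‖Z‖ := by
  intro L hL i U₀ ρ hreg hρ hl b Z bd
  have hFL : (i.1.1.L : ℝ) = (L : ℝ) := by rw [i.2.1]
  have hc₀L : 0 < c₀ L := (hc₀ L).out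
  have hcBL : 0 < cB L := (hcB L).out
  have hL0 : (0 : ℝ) < (L : ℝ) := by exact_mod_cast lt_trans zero_lt_one hL
  have hℓ : (0 : ℝ) < (L : ℝ) ^ (i.1.2.2 - i.1.2.1) := pow_pos hL0 _
  have hδL := hδ L hL
  -- the member at the cap `α L`
  have hregα : RegPr i.1.1 i.1.2.1 i.1.2.2 (α L) U₀ := regPr_mono (F := i.1.1) hρ hreg
  have hεw : 10 ^ 10 * (i.1.1.L : ℝ) ^ 6 * α L ≤ 1 := by rw [hFL]; exact hW L hL
  have hεw' : 10 ^ 12 * (i.1.1.L : ℝ) ^ 3 * α L ≤ 1 := by rw [hFL]; exact hW' L hL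
  have hCKm : 0 ≤ CK L * ((c₀ L / cB L) * ((L : ℝ) ^ (i.1.2.2 - i.1.2.1)) ^ 3) := mul_nonneg (hCK L hL) (by positivity)
  have hmem := kernelC_of_kinvRow_of_greenColumn i.1.1 i.2.2.le (c₀ L) (cB L) (hα L hL) hεw hεw' U₀ hregα (a L i) (Δx L i) hCKm (hCG L hL) hδL
    (hKinv L hL i U₀ ρ hreg hρ hl) (hGcol L hL i U₀ ρ hreg hρ hl) b Z bd
  rw [hFL] at hmem
  refine hmem.trans (le_of_eq ?_)
  congr 1
  congr 1
  field_simp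
  ring

end Family

end Summit.QuantumFields.YangMills.Theorems.Prop7KernelCDoorOfKinvEntry

end
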